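import Summits.BirchSwinnertonDyer.Rank1Residual.GaloisImage.TransverseLocalPairingVanishing
import Summits.BirchSwinnertonDyer.Rank1Residual.GaloisImage.KolyvaginPrimeTransverseSup
import Summits.BirchSwinnertonDyer.Rank1Residual.GaloisImage.KolyvaginPrimeLocalShapeRat
import Literature.NumberTheory.GaloisCohomology.PoitouTateTransverseDuality
import Literature.NumberTheory.GaloisRepresentations.InertiaRootsOfUnity
import Literature.NumberTheory.GaloisRepresentations.TameInertiaKummerProofs
import Literature.NumberTheory.GaloisRepresentations.GaloisRepUnramifiedProofs
import HarnessLib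

/-!
# `TransverseOrthogonal` (Mazur–Rubin Prop. 1.3.2 (ii), both clauses) PROVED for every PERFECT
# family of local invariant maps at ODD `n` — the M2′ binder of ROUTE-1 R1-23 is a theorem, debt 0
# (cell `b2b-bsdres`, team n1011, row T-M2p-K; seat p04 GEN 6; file 3/3)

HONEST FRAMING (cell `b2b-bsdres`, run/shared/lean/b2b/bsd-rank1-residual/, verbatim in every
file): the goal of the cell is to DELETE the COMBINATION-SHAPED residual classes of the
Birch–Swinnerton-Dyer formula for ALL analytic-rank `≤ 1` elliptic curves over `ℚ` — "full BSD
formula for every rank `≤ 1` curve in class `C`" assembled STRICTLY from published theorems — so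
that the rank-`≤ 1` remainder becomes exactly the CONSTRUCTION-SHAPED classes, which are TYPED
(missing-input `Prop`s), NOT attempted. This is not "finishing BSD". Team n1011 (N10 / N11, the
additive block X4 ∧ `p = 3`): research route on the CONSTRUCTION-SHAPED class X4 (§I N11); no claim
beyond the stated classes; nothing is booked; no mark / label is changed by this file. Theorems
only (no definition, no named fact, no `sorry`); TOOL theorems of local Galois cohomology.

## What and why

n1011-lit's predicate `LocalInvariants.TransverseOrthogonal inv`
(`Literature/NumberTheory/GaloisCohomology/PoitouTateTransverseDuality.lean`) types Mazur–Rubin,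
*Kolyvagin systems* (2004) Prop. 1.3.2 (ii) / Rubin PCMI Prop. 1.9.5 (4) — "`H¹_tr(K,T)` and
`H¹_tr(K,T^*)` are orthogonal complements under `⟨ , ⟩`" — for a family `inv` of local invariant
maps: at every finite place `v` of prime norm `ℓ`, `v ∤ n`, for every finite `n`-torsion `M`
unramified at `v` and killed by `ℓ − 1`, with `χ̄_ℓ` onto on the inertia of `K_v`, (1) the dual
local condition of `H¹_tr(K_v, M)` IS `H¹_tr(K_v, M^D)` and (2) a class annihilating `H¹_tr(K_v, M^D)`
is transverse.  It was commissioned (lead R5-44 (d)) as a fifth PROPERTY of the Poitou–Tate family,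
i.e. one more named fact; the consumer is p18's R1-23 binder `hTr` (the count
`#H¹_{𝓚(d)} = #H¹_{𝓚(d)^*}` at a transverse level).  THIS FILE PROVES IT, for every number field `K`,
from the properties every N11 consumer already carries:

**`TransverseCup.transverseOrthogonal_of_isPerfect_of_odd (inv : LocalInvariants K n) (hn : Odd n)
(hperf : inv.IsPerfect) (hur : inv.UnramifiedOrthogonal) : inv.TransverseOrthogonal`.**

Proof (no counting, no class field theory): orthogonality `H¹_tr(M^D) ⊥ H¹_tr(M)` is the theorem
of `TransverseLocalPairingVanishing.lean` (odd `n`; every `inv_v`); for the complements decompose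
along p18's (UT) `H¹ = H¹_ur + H¹_tr` (`unramifiedSubgroup_sup_transverseSubgroup_cyclotomicField_eq_top`,
for `M` AND for `M^D`): if `b = b_ur + b_tr` annihilates `H¹_tr(M)` then so does `b_ur`, which also
annihilates `H¹_ur(M)` (`UnramifiedOrthogonal`, clause 1), hence all of `H¹(K_v, M)`, so `b_ur = 0`
by the injectivity of the right adjoint (`IsPerfect`) and `b = b_tr` is transverse; symmetrically for
clause (2) with the left adjoint.  Local inputs proved here: the inertia group of `K_v` fixes
`μₙ(K̄)|_v` for `v ∤ n` (`toLocal_mu_apply_of_mem_absInertia`: the tree's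
`mem_absInertia_iff_smul_rootsOfUnity` — `I_{K_v}` fixes the roots of unity of order prime to the
residue characteristic — transported along `absGaloisRestrict_apply_smul`), hence `M^D = Hom(M, μₙ)`
is unramified at `v` with `M` (`toLocal_tateDual_apply_of_mem_absInertia`); `(ℓ − 1)·M^D = 0`
(`nsmul_tateDual_eq_zero`); `char 𝓀(K_v) = ℓ` and `ℓ ∤ n` from `N(v) = ℓ`, `v ∤ n`.

Corollaries in the consumers' currency: `dualLocalCondition_cyclotomicTransverse_of_isPerfect_of_odd`
(lit's use lemma `TransverseOrthogonal.dualLocalCondition_cyclotomicTransverse_absNorm` with `hTr`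
discharged: `(cyclotomicTransverse ρ)_q^* = (cyclotomicTransverse ρ^D)_q`), and
**`exists_localInvariants_transverseOrthogonal_of_odd`**: from the FOUR-property fact
`poitouTate_selmerStructure_duality K`, for every ODD `n` there is a family with all FIVE properties —
the true part of the retracted `∀ n` five-property statement (n1011-lit LIT-INPUTS-P3 §49), as a
theorem.  "Odd" is sharp (`n = 2`, `K = ℚ`, `v = 3`, `M = ℤ/2`: `(−3, −3)₃ = −1`).

References: B. Mazur, K. Rubin, Mem. AMS 168 (2004) no. 799, Prop. 1.3.2 (ii) (p. 12)
[MazurRubin2004]; K. Rubin, PCMI 18 (2011), Prop. 1.9.5 (4) (p. 14) [Rubin2011]; J. S. Milne,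
*Arithmetic Duality Theorems* (2006), I Cor. 2.3, Thm. 2.6 [MilneADT2006]; J.-P. Serre, *Local
Fields* (1979), IV §4 Cor. 2 to Prop. 16 (inertia fixes the prime-to-`p` roots of unity)
[SerreLocalFields1979].
-/

noncomputable section

open CategoryTheory Function
open scoped ContRepresentation

universe u

namespace Summit.BirchSwinnertonDyer.Rank1Residual.GaloisImage

namespace TransverseCup

open Field ValuativeRel NumberField IsDedekindDomain
open Literature.NumberTheory.GaloisRepresentations
open Literature.NumberTheory.GaloisRepresentations.IsNonarchimedeanLocalField
open _root_.TopRep _root_.ContRepresentation _root_.ContinuousCohomology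
open Literature.NumberTheory.GaloisCohomology
open scoped NumberField

variable {K : Type u} [Field K] [NumberField K]

/-! ## Local inputs: `μₙ` and `M^D` are unramified at `v ∤ n`; `(ℓ−1)·M^D = 0` -/

section Inertia

variable {M : Type u} [AddCommGroup M] [TopologicalSpace M] [DiscreteTopology M] [Finite M]
  (ρ : DiscreteGaloisModule K M) (n : ℕ) (v : HeightOneSpectrum (𝓞 K))

/-- `ℓ ∤ n` for a place `v ∤ n` of norm `ℓ` (`ℓ ∈ v`, `Ideal.absNorm_mem`). [folklore] -/
theorem not_dvd_of_natCast_not_mem {ℓ : ℕ} (hℓ : Ideal.absNorm v.asIdeal = ℓ)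
    (hv : ((n : ℕ) : 𝓞 K) ∉ v.asIdeal) : ¬ ℓ ∣ n := by
  rintro ⟨c, rfl⟩
  apply hv
  have hmem : ((Ideal.absNorm v.asIdeal : ℕ) : 𝓞 K) ∈ v.asIdeal := Ideal.absNorm_mem v.asIdeal
  rw [hℓ] at hmem
  rw [Nat.cast_mul]
  exact v.asIdeal.mul_mem_right _ hmem

/-- The residue characteristic of `K_v` is `ℓ = N(v)` when the norm is prime (p18's
`ringChar_residueField_adicCompletion_eq`). [folklore] -/
theorem ringChar_residueField_eq_of_absNorm_eq {ℓ : ℕ} [Fact ℓ.Prime]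
    (hℓ : Ideal.absNorm v.asIdeal = ℓ) : ringChar 𝓀[v.adicCompletion K] = ℓ := by
  haveI : Fact (Ideal.absNorm v.asIdeal).Prime := ⟨hℓ ▸ Fact.out⟩
  rw [← hℓ]
  exact ringChar_residueField_adicCompletion_eq v

/-- **The inertia group of `K_v` fixes `μₙ(K̄)` for `v ∤ n`** (the local module `μₙ|_{Γ_{K_v}}` is
unramified): `n` is a unit of `𝒪[K_v]` (`N(v) = ℓ` prime, `ℓ ∤ n`), so the inertia group fixes the
`n`-th roots of unity of `K̄_v` (`mem_absInertia_iff_smul_rootsOfUnity`: Serre, *Local Fields* IV §4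
Cor. 2 to Prop. 16), in particular the images of those of `K̄` under the chosen embedding
(`absGaloisRestrict_apply_smul`). [cite: SerreLocalFields1979, Ch. IV §4 Cor. 2 to Prop. 16] -/
theorem toLocal_mu_apply_of_mem_absInertia {ℓ : ℕ} [Fact ℓ.Prime]
    (hℓ : Ideal.absNorm v.asIdeal = ℓ) (hv : ((n : ℕ) : 𝓞 K) ∉ v.asIdeal)
    {t : absoluteGaloisGroup (v.adicCompletion K)} (ht : t ∈ absInertia (v.adicCompletion K))
    (ζ : DiscreteGaloisModule.MuCarrier K n) :
    GaloisRep.toLocal v (DiscreteGaloisModule.mu K n) t ζ = ζ := by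
  have hunit : IsUnit ((n : ℕ) : 𝒪[v.adicCompletion K]) :=
    isUnit_natCast_of_not_ringChar_dvd (v.adicCompletion K)
      (by rw [ringChar_residueField_eq_of_absNorm_eq v hℓ]; exact not_dvd_of_natCast_not_mem n v hℓ hv)
  set u : (AlgebraicClosure K)ˣ :=
    (((DiscreteGaloisModule.MuCarrier.toAdditive ζ).toMul : rootsOfUnity n (AlgebraicClosure K)) :
      (AlgebraicClosure K)ˣ) with hu
  have hun : (u : AlgebraicClosure K) ^ n = 1 := by
    have h := ((DiscreteGaloisModule.MuCarrier.toAdditive ζ).toMul).2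
    rw [mem_rootsOfUnity] at h
    rw [← Units.val_pow_eq_pow_val, hu, h, Units.val_one]
  -- the embedded root of unity is fixed by the inertia of `K_v`
  have hfixL : t • absClosureEmbedding K (v.adicCompletion K) (u : AlgebraicClosure K) =
      absClosureEmbedding K (v.adicCompletion K) (u : AlgebraicClosure K) :=
    (mem_absInertia_iff_smul_rootsOfUnity.1 ht) n hunit _
      (by rw [← map_pow, hun, map_one])
  have hfix : absGaloisRestrict K (v.adicCompletion K) t • (u : AlgebraicClosure K) = u := by
    apply (absClosureEmbedding K (v.adicCompletion K)).toRingHom.injective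
    exact (absGaloisRestrict_apply_smul K (v.adicCompletion K) t _).trans hfixL
  change Additive.ofMul (absGaloisRestrict K (v.adicCompletion K) t • Additive.toMul ζ) =
    Additive.ofMul (Additive.toMul ζ)
  refine congrArg Additive.ofMul (Subtype.ext (Units.ext ?_))
  rw [absoluteGaloisGroup.coe_smul_rootsOfUnity, Units.coe_smul]
  exact hfix

/-- **`M^D = Hom(M, μₙ)` is unramified at `v ∤ n` when `M` is**: `(σf)(m) = σ(f(σ⁻¹m)) = f(m)` for
`σ` in the inertia group of `K_v` (`GaloisRep.isUnramifiedAt_iff_toLocal_holds` for `M`,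
`toLocal_mu_apply_of_mem_absInertia` for `μₙ`). [folklore] -/
theorem toLocal_tateDual_apply_of_mem_absInertia {ℓ : ℕ} [Fact ℓ.Prime]
    (hℓ : Ideal.absNorm v.asIdeal = ℓ) (hv : ((n : ℕ) : 𝓞 K) ∉ v.asIdeal)
    (hur : GaloisRep.IsUnramifiedAt v ρ)
    {t : absoluteGaloisGroup (v.adicCompletion K)} (ht : t ∈ absInertia (v.adicCompletion K))
    (f : DiscreteGaloisModule.TateDual K M n) : GaloisRep.toLocal v (ρ.tateDual n) t f = f := by
  refine DiscreteGaloisModule.TateDual.ext fun m => ?_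
  change ρ.tateDual n (absGaloisRestrict K (v.adicCompletion K) t) f m = f m
  rw [DiscreteGaloisModule.tateDual_apply_apply_apply]
  have h1 : ρ (absGaloisRestrict K (v.adicCompletion K) t)⁻¹ m = m := by
    have h := (GaloisRep.isUnramifiedAt_iff_toLocal_holds v ρ).1 hur t⁻¹ ((absInertia _).inv_mem ht)
    rw [← map_inv]
    change GaloisRep.toLocal v ρ t⁻¹ m = m
    rw [h]
    rfl
  rw [h1]
  exact toLocal_mu_apply_of_mem_absInertia n v hℓ hv ht (f m)

omit [NumberField K] [TopologicalSpace M] [DiscreteTopology M] [Finite M] in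
/-- `(c·f)(m) = c·f(m)` on the Tate dual. [folklore] -/
theorem nsmul_tateDual_apply (c : ℕ) (f : DiscreteGaloisModule.TateDual K M n) (m : M) :
    (c • f) m = c • f m := by
  induction c with
  | zero => rw [zero_nsmul, zero_nsmul, DiscreteGaloisModule.TateDual.zero_apply]
  | succ c ih => rw [succ_nsmul, succ_nsmul, DiscreteGaloisModule.TateDual.add_apply, ih]

omit [NumberField K] [TopologicalSpace M] [DiscreteTopology M] [Finite M] in
/-- An integer killing `M` kills `M^D = Hom(M, μₙ)` ("`|F^×|·T = 0` ⟹ `|F^×|·T^* = 0`"). [folklore] -/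
theorem nsmul_tateDual_eq_zero {c : ℕ} (hM : ∀ m : M, c • m = 0)
    (f : DiscreteGaloisModule.TateDual K M n) : c • f = 0 := by
  refine DiscreteGaloisModule.TateDual.ext fun m => ?_
  rw [nsmul_tateDual_apply, ← map_nsmul, hM, map_zero, DiscreteGaloisModule.TateDual.zero_apply]

end Inertia

/-! ## `TransverseOrthogonal` for every perfect family at odd `n` -/

section Main

variable {n : ℕ}

/-- **Mazur–Rubin Prop. 1.3.2 (ii) / Rubin PCMI Prop. 1.9.5 (4) for EVERY perfect family at ODD `n`**:
n1011-lit's predicate `LocalInvariants.TransverseOrthogonal inv` — at every finite place `v` of prime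
norm `ℓ`, `v ∤ n`, for every finite `n`-torsion `M` unramified at `v`, killed by `ℓ − 1`, with `χ̄_ℓ`
onto on the inertia of `K_v`: "`H¹_tr(K,T)` and `H¹_tr(K,T^*)` are orthogonal complements under
`⟨ , ⟩`" (both clauses) — follows from `Odd n`, `inv.IsPerfect` and `inv.UnramifiedOrthogonal`.
Orthogonality: `TransverseCup.transverseSubgroup_tateDual_le_dualLocalCondition` /
`localTatePairingZMod_eq_zero_of_mem_transverseSubgroup` (pure group cohomology at odd `n`);
complements: decompose along (UT) `H¹ = H¹_ur + H¹_tr` for `M` and `M^D`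
(`unramifiedSubgroup_sup_transverseSubgroup_cyclotomicField_eq_top`), kill the unramified component
with `UnramifiedOrthogonal` and the injectivity of the adjoints (`IsPerfect`).  No class field theory,
no counting; "odd" is sharp (`n = 2`: `(−3,−3)₃ = −1`).
[cite: MazurRubin2004, Prop. 1.3.2 (ii) (p. 12)] [cite: Rubin2011, Prop. 1.9.5 (4) (p. 14)] -/
theorem transverseOrthogonal_of_isPerfect_of_odd (inv : LocalInvariants K n) (hn : Odd n)
    (hperf : inv.IsPerfect) (hur : inv.UnramifiedOrthogonal) : inv.TransverseOrthogonal := by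
  intro M _ _ _ _ ρ hnM v ℓ _ _ hℓ hv hρur hM hχI
  classical
  haveI : NeZero n := ⟨hn.pos.ne'⟩
  haveI : Finite (DiscreteGaloisModule.TateDual K M n) :=
    DiscreteGaloisModule.TateDual.finite (K := K) (M := M) n
  -- local inputs
  have hI : ∀ t ∈ absInertia (v.adicCompletion K), ∀ m : M, GaloisRep.toLocal v ρ t m = m := by
    intro t ht m
    have h := (GaloisRep.isUnramifiedAt_iff_toLocal_holds v ρ).1 hρur t ht
    rw [h]
    rfl
  have hID : ∀ t ∈ absInertia (v.adicCompletion K), ∀ f : DiscreteGaloisModule.TateDual K M n,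
      GaloisRep.toLocal v (ρ.tateDual n) t f = f :=
    fun t ht f => toLocal_tateDual_apply_of_mem_absInertia ρ n v hℓ hv hρur ht f
  have hMD : ∀ f : DiscreteGaloisModule.TateDual K M n, (ℓ - 1) • f = 0 :=
    nsmul_tateDual_eq_zero n hM
  have hchar : ringChar 𝓀[v.adicCompletion K] = ℓ := ringChar_residueField_eq_of_absNorm_eq v hℓ
  -- (UT) for `M` and `M^D` (p18)
  have hUT := unramifiedSubgroup_sup_transverseSubgroup_cyclotomicField_eq_top
    (GaloisRep.toLocal v ρ) ℓ hchar hI hM hχI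
  have hUTD := unramifiedSubgroup_sup_transverseSubgroup_cyclotomicField_eq_top
    (GaloisRep.toLocal v (ρ.tateDual n)) ℓ hchar hID hMD hχI
  -- unramified ↔ unramified (Milne I 2.6 for the family) and perfectness at `v`
  have hUO := (hur ρ hnM v hv hρur).1
  have hP := (hperf v).2 ρ hnM
  -- the orthogonality (file 2/3): transverse ⊥ transverse
  have horth := fun (a : galoisCohomology (ρ.toLocal (Sum.inr v)) 1)
      (ha : a ∈ DiscreteGaloisModule.transverseSubgroup (GaloisRep.toLocal v ρ)
        (CyclotomicField ℓ (v.adicCompletion K)))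
      (b : galoisCohomology ((ρ.tateDual n).toLocal (Sum.inr v)) 1)
      (hb : b ∈ DiscreteGaloisModule.transverseSubgroup (GaloisRep.toLocal v (ρ.tateDual n))
        (CyclotomicField ℓ (v.adicCompletion K))) =>
    localTatePairingZMod_eq_zero_of_mem_transverseSubgroup ρ n v ℓ hn hI hID hχI (inv (Sum.inr v)) ha hb
  -- shorthand facts, elementwise
  have hUO' : ∀ a : galoisCohomology (ρ.toLocal (Sum.inr v)) 1,
      a ∈ DiscreteGaloisModule.unramifiedSubgroup (GaloisRep.toLocal v ρ) 1 →
      ∀ b : galoisCohomology ((ρ.tateDual n).toLocal (Sum.inr v)) 1,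
      b ∈ DiscreteGaloisModule.unramifiedSubgroup (GaloisRep.toLocal v (ρ.tateDual n)) 1 →
      DiscreteGaloisModule.localTatePairingZMod ρ n (Sum.inr v) (inv (Sum.inr v)) a b = 0 :=
    fun a ha b hb => (LocalInvariants.mem_dualLocalCondition_iff inv ρ (Sum.inr v) _ b).1 (hUO.ge hb) a ha
  refine ⟨le_antisymm (fun b hb => ?_)
    (transverseSubgroup_tateDual_le_dualLocalCondition ρ n v ℓ hn hI hID hχI inv), fun a ha => ?_⟩
  · -- `b` annihilates `H¹_tr(M)`; decompose `b = bf + bt` along (UT) for `M^D`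
    have hbmem : b ∈ DiscreteGaloisModule.unramifiedSubgroup (GaloisRep.toLocal v (ρ.tateDual n)) 1 ⊔
        DiscreteGaloisModule.transverseSubgroup (GaloisRep.toLocal v (ρ.tateDual n))
          (CyclotomicField ℓ (v.adicCompletion K)) := by
      rw [hUTD]; exact AddSubgroup.mem_top b
    obtain ⟨bf, hbf, bt, hbt, rfl⟩ := AddSubgroup.mem_sup.1 hbmem
    have hb' := (LocalInvariants.mem_dualLocalCondition_iff inv ρ (Sum.inr v) _ _).1 hb
    -- `bf` annihilates `H¹_tr(M)` (as `bt` does) and `H¹_ur(M)`, hence all of `H¹(K_v, M)`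
    have hbf_all : ∀ a : galoisCohomology (ρ.toLocal (Sum.inr v)) 1,
        DiscreteGaloisModule.localTatePairingZMod ρ n (Sum.inr v) (inv (Sum.inr v)) a bf = 0 := by
      intro a
      have hamem : a ∈ DiscreteGaloisModule.unramifiedSubgroup (GaloisRep.toLocal v ρ) 1 ⊔
          DiscreteGaloisModule.transverseSubgroup (GaloisRep.toLocal v ρ)
            (CyclotomicField ℓ (v.adicCompletion K)) := by
        rw [hUT]; exact AddSubgroup.mem_top a
      obtain ⟨af, haf, at', hat, rfl⟩ := AddSubgroup.mem_sup.1 hamem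
      have hsplit := DFunLike.congr_fun
        (map_add (DiscreteGaloisModule.localTatePairingZMod ρ n (Sum.inr v) (inv (Sum.inr v))) af at') bf
      rw [AddMonoidHom.add_apply] at hsplit
      rw [hsplit, hUO' af haf bf hbf, zero_add]
      -- the transverse part: `⟨at, bf⟩ = ⟨at, bf + bt⟩ - ⟨at, bt⟩ = 0 - 0`
      have h1 := hb' at' hat
      have h2 : DiscreteGaloisModule.localTatePairingZMod ρ n (Sum.inr v) (inv (Sum.inr v)) at' (bf + bt) =
          DiscreteGaloisModule.localTatePairingZMod ρ n (Sum.inr v) (inv (Sum.inr v)) at' bf +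
          DiscreteGaloisModule.localTatePairingZMod ρ n (Sum.inr v) (inv (Sum.inr v)) at' bt :=
        map_add _ bf bt
      rw [h2, horth at' hat bt hbt, add_zero] at h1
      exact h1
    have hflip : (DiscreteGaloisModule.localTatePairingZMod ρ n (Sum.inr v) (inv (Sum.inr v))).flip bf = 0 :=
      AddMonoidHom.ext fun a => by
        rw [AddMonoidHom.flip_apply, AddMonoidHom.zero_apply]; exact hbf_all a
    have hbf0 : bf = 0 := hP.2.1 (hflip.trans (map_zero _).symm)
    have hbf_tr : bf ∈ DiscreteGaloisModule.transverseSubgroup (GaloisRep.toLocal v (ρ.tateDual n))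
        (CyclotomicField ℓ (v.adicCompletion K)) := by
      rw [hbf0]; exact zero_mem _
    exact add_mem hbf_tr hbt
  · -- `a` annihilates `H¹_tr(M^D)`; decompose `a = af + at` along (UT) for `M`
    have hamem : a ∈ DiscreteGaloisModule.unramifiedSubgroup (GaloisRep.toLocal v ρ) 1 ⊔
        DiscreteGaloisModule.transverseSubgroup (GaloisRep.toLocal v ρ)
          (CyclotomicField ℓ (v.adicCompletion K)) := by
      rw [hUT]; exact AddSubgroup.mem_top a
    obtain ⟨af, haf, at', hat, rfl⟩ := AddSubgroup.mem_sup.1 hamem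
    have hsplit : DiscreteGaloisModule.localTatePairingZMod ρ n (Sum.inr v) (inv (Sum.inr v)) (af + at') =
        DiscreteGaloisModule.localTatePairingZMod ρ n (Sum.inr v) (inv (Sum.inr v)) af +
        DiscreteGaloisModule.localTatePairingZMod ρ n (Sum.inr v) (inv (Sum.inr v)) at' :=
      map_add _ af at'
    -- `af` annihilates `H¹_tr(M^D)` (as `at` does) and `H¹_ur(M^D)`, hence all of `H¹(K_v, M^D)`
    have haf_all : ∀ b : galoisCohomology ((ρ.tateDual n).toLocal (Sum.inr v)) 1,
        DiscreteGaloisModule.localTatePairingZMod ρ n (Sum.inr v) (inv (Sum.inr v)) af b = 0 := by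
      intro b
      have hbmem : b ∈ DiscreteGaloisModule.unramifiedSubgroup (GaloisRep.toLocal v (ρ.tateDual n)) 1 ⊔
          DiscreteGaloisModule.transverseSubgroup (GaloisRep.toLocal v (ρ.tateDual n))
            (CyclotomicField ℓ (v.adicCompletion K)) := by
        rw [hUTD]; exact AddSubgroup.mem_top b
      obtain ⟨bf, hbf, bt, hbt, rfl⟩ := AddSubgroup.mem_sup.1 hbmem
      have h2 : DiscreteGaloisModule.localTatePairingZMod ρ n (Sum.inr v) (inv (Sum.inr v)) af (bf + bt) =
          DiscreteGaloisModule.localTatePairingZMod ρ n (Sum.inr v) (inv (Sum.inr v)) af bf +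
          DiscreteGaloisModule.localTatePairingZMod ρ n (Sum.inr v) (inv (Sum.inr v)) af bt :=
        map_add _ bf bt
      rw [h2, hUO' af haf bf hbf, zero_add]
      -- the transverse part: `⟨af, bt⟩ = ⟨af + at, bt⟩ - ⟨at, bt⟩ = 0 - 0`
      have h1 := ha bt hbt
      have h3 := DFunLike.congr_fun hsplit bt
      rw [AddMonoidHom.add_apply] at h3
      rw [h3, horth at' hat bt hbt, add_zero] at h1
      exact h1
    have hzero : DiscreteGaloisModule.localTatePairingZMod ρ n (Sum.inr v) (inv (Sum.inr v)) af = 0 :=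
      AddMonoidHom.ext fun b => by rw [AddMonoidHom.zero_apply]; exact haf_all b
    have haf0 : af = 0 := hP.1.1 (hzero.trans (map_zero _).symm)
    have haf_tr : af ∈ DiscreteGaloisModule.transverseSubgroup (GaloisRep.toLocal v ρ)
        (CyclotomicField ℓ (v.adicCompletion K)) := by
      rw [haf0]; exact zero_mem _
    exact add_mem haf_tr hat

/-- **`(cyclotomicTransverse ρ)_q^* = (cyclotomicTransverse ρ^D)_q` for every PERFECT family at odd
`n`** — n1011-lit's use lemma `TransverseOrthogonal.dualLocalCondition_cyclotomicTransverse_absNorm`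
with its `TransverseOrthogonal` hypothesis DISCHARGED (p18's R1-23 currency: `ℓ := N(q)` prime,
`q ∤ n`, `M` unramified at `q` and killed by `n` and `N(q) − 1`, `χ̄_{N(q)}` onto on inertia).
[cite: MazurRubin2004, Prop. 1.3.2 (ii) (p. 12)] [cite: Rubin2011, Prop. 1.9.5 (4) (p. 14)] -/
theorem dualLocalCondition_cyclotomicTransverse_of_isPerfect_of_odd (inv : LocalInvariants K n)
    (hn : Odd n) (hperf : inv.IsPerfect) (hur : inv.UnramifiedOrthogonal)
    {M : Type u} [AddCommGroup M] [TopologicalSpace M] [DiscreteTopology M] [Finite M]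
    (ρ : DiscreteGaloisModule K M) (hnM : ∀ m : M, n • m = 0) (q : HeightOneSpectrum (𝓞 K))
    [Fact (Ideal.absNorm q.asIdeal).Prime]
    [NeZero ((Ideal.absNorm q.asIdeal : ℕ) : q.adicCompletion K)]
    (hq : ((n : ℕ) : 𝓞 K) ∉ q.asIdeal) (hρur : GaloisRep.IsUnramifiedAt q ρ)
    (hM : ∀ m : M, (Ideal.absNorm q.asIdeal - 1) • m = 0)
    (hχI : ∀ u : (ZMod (Ideal.absNorm q.asIdeal))ˣ, ∃ t ∈ absInertia (q.adicCompletion K),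
      modPCyclotomicCharacterZMod (q.adicCompletion K) (Ideal.absNorm q.asIdeal) t = u) :
    inv.dualLocalCondition ρ (Sum.inr q) (cyclotomicTransverse ρ (Sum.inr q)) =
      cyclotomicTransverse (ρ.tateDual n) (Sum.inr q) :=
  (transverseOrthogonal_of_isPerfect_of_odd inv hn hperf hur).dualLocalCondition_cyclotomicTransverse_absNorm
    ρ hnM q hq hρur hM hχI

/-- **For every ODD `n` there is a family of local invariant maps with ALL FIVE properties**
(`IsPerfect`, `SumLocalTermEqZero`, `UnramifiedOrthogonal`, `SelmerComplement`, `TransverseOrthogonal`),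
from the FOUR-property fact `poitouTate_selmerStructure_duality K` (Milne I Cor. 2.3, Thm. 4.10(b),
Thm. 2.6; Howard Thm. 2.1.11): the fifth is a theorem of the first and third at odd `n`.  (At even `n`
the five-property statement is false: `n = 2`, `K = ℚ`, `v = 3`, `M = ℤ/2`.)
[cite: MazurRubin2004, Prop. 1.3.2 (ii) (p. 12)] [cite: MilneADT2006, Ch. I, Cor. 2.3 and Thm. 2.6] -/
theorem exists_localInvariants_transverseOrthogonal_of_odd (h : poitouTate_selmerStructure_duality K)
    (n : ℕ) [NeZero n] (hn : Odd n) :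
    ∃ inv : LocalInvariants K n, inv.IsPerfect ∧ inv.SumLocalTermEqZero ∧ inv.UnramifiedOrthogonal ∧
      inv.SelmerComplement ∧ inv.TransverseOrthogonal := by
  obtain ⟨inv, hperf, hsum, hur, hcompl⟩ := h n
  exact ⟨inv, hperf, hsum, hur, hcompl, transverseOrthogonal_of_isPerfect_of_odd inv hn hperf hur⟩

end Main

end TransverseCup

end Summit.BirchSwinnertonDyer.Rank1Residual.GaloisImage

end
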